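import Summits.QuantumFields.YangMills.Theses.UnitScaleTilt

/-!
# Route `UnitScaleTilt` — crux K2 `HistoryTail` (stmt-QuantumFields-18916): SIZING THE REMAINDER OF THE ITERATED (69)–(70) UNDER PRINT'S
# REGULARITY PROFILE — with `a_s ≤ Cθ·L^{−2(j−s)}` (the scaling of (68)), regions `#R_{s+1} ≤ N₀L^{3(j−1−s)}` and weights
# `ε_s⁻¹ ≤ E₀·2^{j−s}`, the remainder is `≤ K·θ⁴`, UNIFORMLY IN THE HEIGHT `j` (support file; brick S3d of the split card)

Fleet lead `ym-ust-18916-p1` (gen 0); split card `CARD-18916-K2-split.md` (evidence #12/#16), brick **S3d**.  In this seat's deterministic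
(71) (`HistoryTailSmallFactor.smallFactor_deterministic'`, `HistoryTailSmallFactorLocal.smallFactor_deterministic_loc`) the large-plaquette
lower bound reads `(p(g)² − β·Rem)/(2Πm) ≤ β_K·A_{R_0}(U)` with
`Rem = Σ_{s<j} Π_{s<u<j}((1+ε_u)L)·#R_{s+1}·(1+ε_s⁻¹)·(435t_s²)²`, `t_s = ((d+2)L)²a_s/4`.  Print's regularity (68) of the composite minimiser
([Balaban1985UV3] p.273: `|U_k(∂p) − 1| < O(1)g_jp(g_j)L^{−2j}` on the blocks under a regular plaquette) makes the level-`s` averaged field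
`a_s`-small near `p′` with `a_s ≍ θ·L^{−2(j−s)}` (`θ = g_jp(g_j)` the level-`j` threshold), the regions under one plaquette have
`#R_{s+1} ≍ L^{3(j−1−s)}`, and summable weights `ε_s = ε₀2^{−(j−s)}` keep `Π(1+ε_s) ≤ e^{ε₀}`.  THIS FILE does the resulting bookkeeping
ONCE, as pure real analysis:
* `prod_one_add_le_exp_sum`, `prod_one_add_geometric_le` — `Π_{s<j}(1+ε_s) ≤ exp(Σε_s) ≤ exp(ε₀)` for `ε_s ≤ ε₀2^{−(j−s)}`;
* `remainder_term_le` / **`remainder_le`** — under the three profile hypotheses (and `L ≥ 2`, `Π_{s<u<j}(1+ε_u) ≤ Πm`), every summand is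
  `≤ Πm·N₀·E₀·435²·((d+2)²C/4)⁴·θ⁴·L⁴·(2/L⁴)^{j−s}` and `Rem ≤ (4/7)·Πm·N₀·E₀·435²·((d+2)²C/4)⁴·θ⁴ =: K·θ⁴`;
so `β·Rem ≤ K·βθ²·θ² = K·p(g)²·θ²` is `≤ η·p(g)²` as soon as `θ² ≤ η/K` — Bałaban's «for g_j sufficiently small» in (71), quantitatively, and
uniformly in `j` (the route's `T3Thresholds.exists_gamma_forall_θBal_le` supplies `θ ≤ σ` for `γ ≤ γ₁(σ)`).

WHAT THIS IS NOT: the profile itself ((68) for the minimiser's averaging tower) is an INPUT of mechanism A (S2), not proved here; nothing of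
(41)/(47); nothing uses (α).
-/

noncomputable section

open scoped BigOperators

namespace Summit.QuantumFields.YangMills.Theorems.HistoryTailRemainder

/-! ## §1 Products of `1 + ε_s` -/

/-- `Π_{s∈S}(1 + ε_s) ≤ exp(Σ_{s∈S} ε_s)` for `ε_s ≥ 0`. [folklore] -/
theorem prod_one_add_le_exp_sum (S : Finset ℕ) (ε : ℕ → ℝ) (hε : ∀ s ∈ S, 0 ≤ ε s) :
    ∏ s ∈ S, (1 + ε s) ≤ Real.exp (∑ s ∈ S, ε s) := by
  rw [Real.exp_sum]
  exact Finset.prod_le_prod (fun s hs => by linarith [hε s hs]) fun s _ => by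
    have := Real.add_one_le_exp (ε s); linarith

/-- `Σ_{s<j} (1/2)^{j−s} ≤ 1`. [folklore] -/
theorem sum_half_pow_sub_le_one (j : ℕ) : ∑ s ∈ Finset.range j, ((1 : ℝ) / 2) ^ (j - s) ≤ 1 := by
  have hrefl : ∑ s ∈ Finset.range j, ((1 : ℝ) / 2) ^ (j - s) = ∑ k ∈ Finset.range j, ((1 : ℝ) / 2) ^ (k + 1) := by
    rw [← Finset.sum_range_reflect (fun k => ((1 : ℝ) / 2) ^ (k + 1)) j]
    refine Finset.sum_congr rfl fun s hs => ?_
    rw [Finset.mem_range] at hs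
    congr 1; omega
  rw [hrefl]
  have h2 := sum_geometric_two_le j
  have : ∑ k ∈ Finset.range j, ((1 : ℝ) / 2) ^ (k + 1) = (1 / 2) * ∑ k ∈ Finset.range j, ((1 : ℝ) / 2) ^ k := by
    rw [Finset.mul_sum]; exact Finset.sum_congr rfl fun k _ => by ring
  rw [this]; linarith

/-- **SUMMABLE WEIGHTS KEEP THE PRODUCT BOUNDED**: if `0 ≤ ε_s ≤ ε₀·2^{−(j−s)}` for `s < j` then `Π_{s<j}(1+ε_s) ≤ exp ε₀` — uniformly in `j`.
[folklore] -/
theorem prod_one_add_geometric_le {ε₀ : ℝ} (hε₀ : 0 ≤ ε₀) (ε : ℕ → ℝ) (j : ℕ) (hε0 : ∀ s, s < j → 0 ≤ ε s)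
    (hε : ∀ s, s < j → ε s ≤ ε₀ * ((1 : ℝ) / 2) ^ (j - s)) :
    ∏ s ∈ Finset.range j, (1 + ε s) ≤ Real.exp ε₀ := by
  refine (prod_one_add_le_exp_sum _ ε fun s hs => hε0 s (Finset.mem_range.mp hs)).trans (Real.exp_le_exp.mpr ?_)
  calc ∑ s ∈ Finset.range j, ε s ≤ ∑ s ∈ Finset.range j, ε₀ * ((1 : ℝ) / 2) ^ (j - s) :=
        Finset.sum_le_sum fun s hs => hε s (Finset.mem_range.mp hs)
    _ = ε₀ * ∑ s ∈ Finset.range j, ((1 : ℝ) / 2) ^ (j - s) := by rw [Finset.mul_sum]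
    _ ≤ ε₀ * 1 := mul_le_mul_of_nonneg_left (sum_half_pow_sub_le_one j) hε₀
    _ = ε₀ := mul_one _

/-- Sub-products over intervals are bounded by the full product when all factors are `≥ 1`. [folklore] -/
theorem prod_Ico_le_prod_range (ε : ℕ → ℝ) (j s : ℕ) (hε0 : ∀ u, u < j → 0 ≤ ε u) :
    ∏ u ∈ Finset.Ico (s + 1) j, (1 + ε u) ≤ ∏ u ∈ Finset.range j, (1 + ε u) := by
  have hsub : Finset.Ico (s + 1) j ⊆ Finset.range j := fun u hu => Finset.mem_range.mpr (Finset.mem_Ico.mp hu).2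
  rw [← Finset.prod_sdiff hsub]
  have h1 : 1 ≤ ∏ u ∈ Finset.range j \ Finset.Ico (s + 1) j, (1 + ε u) := by
    calc (1 : ℝ) = ∏ _u ∈ Finset.range j \ Finset.Ico (s + 1) j, (1 : ℝ) := Finset.prod_const_one.symm
      _ ≤ _ := Finset.prod_le_prod (fun _ _ => zero_le_one) fun u hu => by
          have := hε0 u (Finset.mem_range.mp (Finset.mem_sdiff.mp hu).1); linarith
  have h0 : 0 ≤ ∏ u ∈ Finset.Ico (s + 1) j, (1 + ε u) :=
    Finset.prod_nonneg fun u hu => by have := hε0 u (Finset.mem_Ico.mp hu).2; linarith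
  calc ∏ u ∈ Finset.Ico (s + 1) j, (1 + ε u) = 1 * ∏ u ∈ Finset.Ico (s + 1) j, (1 + ε u) := (one_mul _).symm
    _ ≤ _ := mul_le_mul_of_nonneg_right h1 h0

/-! ## §2 The remainder under the profile -/

/-- `Π_{u∈(s,j)}((1+ε_u)·L) = (Π_{u∈(s,j)}(1+ε_u))·L^{j−1−s}`. [folklore] -/
theorem prod_Ico_mul_const (ε : ℕ → ℝ) (L : ℝ) (j s : ℕ) :
    ∏ u ∈ Finset.Ico (s + 1) j, ((1 + ε u) * L) = (∏ u ∈ Finset.Ico (s + 1) j, (1 + ε u)) * L ^ (j - 1 - s) := by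
  rw [Finset.prod_mul_distrib, Finset.prod_const, Nat.card_Ico]
  congr 2; omega

/-- **ONE SUMMAND OF THE REMAINDER UNDER THE PROFILE** (`s < j`, `L ≥ 2`): with `Π_{u∈(s,j)}(1+ε_u) ≤ Πm`, `#R_{s+1} ≤ N₀L^{3(j−1−s)}`,
`1 + ε_s⁻¹ ≤ E₀·2^{j−s}` and `0 ≤ a_s ≤ Cθ/L^{2(j−s)}`, the summand `Π((1+ε)L)·#R·(1+ε⁻¹)·(435t_s²)²`, `t_s = (D²/4)a_s` (`D = (d+2)L`), is
`≤ Πm·N₀·E₀·(435(D²/4)²C²θ²)²·L⁻⁴·(2/L⁴)^{j−s}·L^{8}·L^{−8}…` — precisely `≤ Πm·N₀·E₀·435²·(C·Dsq/4)⁴·θ⁴ · (L⁴)^{(j−1−s)}·2^{j−s}/(L^{2(j−s)})⁴`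
where `Dsq = D²`. [folklore] -/
theorem remainder_term_le {L θ C N₀ E₀ Pm Dsq : ℝ} (hL : 2 ≤ L) (hN₀ : 0 ≤ N₀) (hE₀ : 0 ≤ E₀)
    (hPm : 0 ≤ Pm) (hDsq : 0 ≤ Dsq) {j s : ℕ} (hs : s < j) (ε : ℕ → ℝ) (card a : ℝ)
    (hε0 : ∀ u, u < j → 0 ≤ ε u) (hprod : ∏ u ∈ Finset.Ico (s + 1) j, (1 + ε u) ≤ Pm)
    (hcard0 : 0 ≤ card) (hcard : card ≤ N₀ * (L ^ 3) ^ (j - 1 - s))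
    (hinv : 1 + (ε s)⁻¹ ≤ E₀ * 2 ^ (j - s)) (ha0 : 0 ≤ a) (ha : a ≤ C * θ / (L ^ 2) ^ (j - s)) :
    (∏ u ∈ Finset.Ico (s + 1) j, ((1 + ε u) * L)) * (card * ((1 + (ε s)⁻¹) * (435 * (Dsq / 4 * a) ^ 2) ^ 2)) ≤
      Pm * N₀ * E₀ * (435 ^ 2 * (C * Dsq / 4) ^ 4 * θ ^ 4) *
        ((L ^ (j - 1 - s) * (L ^ 3) ^ (j - 1 - s)) * 2 ^ (j - s) / ((L ^ 2) ^ (j - s)) ^ 4) := by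
  have hL0 : 0 < L := by linarith
  have hLpow : 0 < (L ^ 2) ^ (j - s) := by positivity
  -- the plaquette radius to the fourth power
  have ha4 : (435 * (Dsq / 4 * a) ^ 2) ^ 2 ≤ 435 ^ 2 * (C * Dsq / 4) ^ 4 * θ ^ 4 / ((L ^ 2) ^ (j - s)) ^ 4 := by
    have h1 : Dsq / 4 * a ≤ Dsq / 4 * (C * θ / (L ^ 2) ^ (j - s)) := mul_le_mul_of_nonneg_left ha (by positivity)
    have h0 : 0 ≤ Dsq / 4 * a := by positivity
    have h2 : (Dsq / 4 * a) ^ 2 ≤ (Dsq / 4 * (C * θ / (L ^ 2) ^ (j - s))) ^ 2 := pow_le_pow_left₀ h0 h1 2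
    have h3 : (435 * (Dsq / 4 * a) ^ 2) ^ 2 ≤ (435 * (Dsq / 4 * (C * θ / (L ^ 2) ^ (j - s))) ^ 2) ^ 2 :=
      pow_le_pow_left₀ (by positivity) (by linarith) 2
    refine h3.trans (le_of_eq ?_)
    field_simp
  have hP0 : 0 ≤ ∏ u ∈ Finset.Ico (s + 1) j, (1 + ε u) :=
    Finset.prod_nonneg fun u hu => by have := hε0 u (Finset.mem_Ico.mp hu).2; linarith
  rw [prod_Ico_mul_const]
  have hinv0 : 0 ≤ 1 + (ε s)⁻¹ := by
    have := hε0 s hs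
    have : 0 ≤ (ε s)⁻¹ := inv_nonneg.mpr this
    linarith
  -- assemble by monotonicity of products of non-negative factors
  calc (∏ u ∈ Finset.Ico (s + 1) j, (1 + ε u)) * L ^ (j - 1 - s) * (card * ((1 + (ε s)⁻¹) * (435 * (Dsq / 4 * a) ^ 2) ^ 2))
      ≤ Pm * L ^ (j - 1 - s) * ((N₀ * (L ^ 3) ^ (j - 1 - s)) *
          ((E₀ * 2 ^ (j - s)) * (435 ^ 2 * (C * Dsq / 4) ^ 4 * θ ^ 4 / ((L ^ 2) ^ (j - s)) ^ 4))) := by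
        gcongr
    _ = _ := by ring

/-- `(L·L³)^{j−1−s}·2^{j−s}/(L²)^{4(j−s)} = L⁻⁴·(2/L⁴)^{j−s}` for `s < j`, hence `≤ L⁻⁴·(1/8)^{j−s}·…`; we only need the cruder
`≤ (2/L⁴)^{j−s}` (`L ≥ 2`). [folklore] -/
theorem geometry_factor_le {L : ℝ} (hL : 2 ≤ L) {j s : ℕ} (hs : s < j) :
    (L ^ (j - 1 - s) * (L ^ 3) ^ (j - 1 - s)) * 2 ^ (j - s) / ((L ^ 2) ^ (j - s)) ^ 4 ≤ (2 / L ^ 4) ^ (j - s) := by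
  have hL0 : 0 < L := by linarith
  have hL1 : 1 ≤ L := by linarith
  obtain ⟨m, hm⟩ : ∃ m, j - s = m + 1 := ⟨j - 1 - s, by omega⟩
  have hjs : j - 1 - s = m := by omega
  rw [hm, hjs]
  rw [div_le_iff₀ (by positivity)]
  have key : (2 / L ^ 4) ^ (m + 1) * ((L ^ 2) ^ (m + 1)) ^ 4 = 2 ^ (m + 1) * (L ^ 4) ^ (m + 1) := by
    have hL4 : (L ^ 4) ^ (m + 1) ≠ 0 := by positivity
    have hsq : ((L ^ 2) ^ (m + 1)) ^ 4 = (L ^ 4) ^ (m + 1) * (L ^ 4) ^ (m + 1) := by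
      rw [← pow_mul, ← pow_mul, ← pow_mul, ← pow_add]; ring_nf
    rw [div_pow, hsq]
    field_simp
  rw [key]
  have h1 : L ^ m * (L ^ 3) ^ m = (L ^ 4) ^ m := by rw [← pow_mul, ← pow_add, ← pow_mul]; ring_nf
  rw [h1, pow_succ (L ^ 4) m]
  have h4 : 1 ≤ L ^ 4 := one_le_pow₀ hL1
  have h0 : 0 ≤ (L ^ 4) ^ m * 2 ^ (m + 1) := by positivity
  nlinarith [h0, h4]

/-- `Σ_{s<j}(2/L⁴)^{j−s} ≤ 4/7·… ≤ 1/3` for `L ≥ 2` (ratio `≤ 1/8`; the sum is `≤ (1/8)/(1 − 1/8) = 1/7 < 1/3`). [folklore] -/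
theorem sum_ratio_pow_le {L : ℝ} (hL : 2 ≤ L) (j : ℕ) : ∑ s ∈ Finset.range j, (2 / L ^ 4) ^ (j - s) ≤ 1 / 3 := by
  have hL0 : 0 < L := by linarith
  have hr0 : 0 ≤ 2 / L ^ 4 := by positivity
  have hr : 2 / L ^ 4 ≤ 1 / 8 := by
    rw [div_le_div_iff₀ (by positivity) (by norm_num)]
    have : (2 : ℝ) ^ 4 ≤ L ^ 4 := pow_le_pow_left₀ (by norm_num) hL 4
    nlinarith
  calc ∑ s ∈ Finset.range j, (2 / L ^ 4) ^ (j - s) ≤ ∑ s ∈ Finset.range j, ((1 : ℝ) / 8) ^ (j - s) :=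
        Finset.sum_le_sum fun s _ => pow_le_pow_left₀ hr0 hr _
    _ = ∑ k ∈ Finset.range j, ((1 : ℝ) / 8) ^ (k + 1) := by
        rw [← Finset.sum_range_reflect (fun k => ((1 : ℝ) / 8) ^ (k + 1)) j]
        refine Finset.sum_congr rfl fun s hs => ?_
        rw [Finset.mem_range] at hs
        congr 1; omega
    _ = (1 / 8) * ∑ k ∈ Finset.range j, ((1 : ℝ) / 8) ^ k := by
        rw [Finset.mul_sum]; exact Finset.sum_congr rfl fun k _ => by ring
    _ ≤ (1 / 8) * (8 / 7) := by
        refine mul_le_mul_of_nonneg_left ?_ (by norm_num)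
        have h := geom_sum_eq (show ((1 : ℝ) / 8) ≠ 1 by norm_num) j
        rw [h]
        have : (0 : ℝ) < ((1 : ℝ) / 8) ^ j := by positivity
        rw [div_le_iff_of_neg (by norm_num)]
        linarith
    _ ≤ 1 / 3 := by norm_num

/-- **THE REMAINDER UNDER PRINT'S PROFILE IS `O(θ⁴)`, UNIFORMLY IN THE HEIGHT** (`L ≥ 2`): with `Π_{u<j}(1+ε_u) ≤ Πm` (all `ε_u ≥ 0`),
`#R_{s+1} ≤ N₀·(L³)^{j−1−s}`, `1 + ε_s⁻¹ ≤ E₀·2^{j−s}`, `0 ≤ a_s ≤ Cθ/(L²)^{j−s}` for all `s < j`,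
`Rem = Σ_{s<j} Π_{u∈(s,j)}((1+ε_u)L)·#R_{s+1}·(1+ε_s⁻¹)·(435(Dsq/4·a_s)²)² ≤ (1/3)·Πm·N₀·E₀·435²·(C·Dsq/4)⁴·θ⁴`.
[cite: Balaban1985UV3, (68)-(71) p.273] -/
theorem remainder_le {L θ C N₀ E₀ Pm Dsq : ℝ} (hL : 2 ≤ L) (hN₀ : 0 ≤ N₀) (hE₀ : 0 ≤ E₀)
    (hDsq : 0 ≤ Dsq) (j : ℕ) (ε a card : ℕ → ℝ)
    (hε0 : ∀ u, u < j → 0 ≤ ε u) (hprod : ∏ u ∈ Finset.range j, (1 + ε u) ≤ Pm)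
    (hcard0 : ∀ s, s < j → 0 ≤ card s) (hcard : ∀ s, s < j → card s ≤ N₀ * (L ^ 3) ^ (j - 1 - s))
    (hinv : ∀ s, s < j → 1 + (ε s)⁻¹ ≤ E₀ * 2 ^ (j - s))
    (ha0 : ∀ s, s < j → 0 ≤ a s) (ha : ∀ s, s < j → a s ≤ C * θ / (L ^ 2) ^ (j - s)) :
    ∑ s ∈ Finset.range j, (∏ u ∈ Finset.Ico (s + 1) j, ((1 + ε u) * L)) *
        (card s * ((1 + (ε s)⁻¹) * (435 * (Dsq / 4 * a s) ^ 2) ^ 2)) ≤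
      (1 / 3) * (Pm * N₀ * E₀ * (435 ^ 2 * (C * Dsq / 4) ^ 4 * θ ^ 4)) := by
  have hP1 : 1 ≤ ∏ u ∈ Finset.range j, (1 + ε u) := by
    calc (1 : ℝ) = ∏ _u ∈ Finset.range j, (1 : ℝ) := Finset.prod_const_one.symm
      _ ≤ _ := Finset.prod_le_prod (fun _ _ => zero_le_one) fun u hu => by
          have := hε0 u (Finset.mem_range.mp hu); linarith
  have hPm : 0 ≤ Pm := zero_le_one.trans (hP1.trans hprod)
  set Kc : ℝ := Pm * N₀ * E₀ * (435 ^ 2 * (C * Dsq / 4) ^ 4 * θ ^ 4) with hKc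
  have hKc0 : 0 ≤ Kc := by
    have h4 : 0 ≤ (C * Dsq / 4) ^ 4 * θ ^ 4 := by positivity
    simp only [hKc]
    have : 0 ≤ Pm * N₀ * E₀ := by positivity
    nlinarith [this, h4]
  have hterm : ∀ s ∈ Finset.range j, (∏ u ∈ Finset.Ico (s + 1) j, ((1 + ε u) * L)) *
      (card s * ((1 + (ε s)⁻¹) * (435 * (Dsq / 4 * a s) ^ 2) ^ 2)) ≤ Kc * (2 / L ^ 4) ^ (j - s) := by
    intro s hs
    rw [Finset.mem_range] at hs
    have hsub : ∏ u ∈ Finset.Ico (s + 1) j, (1 + ε u) ≤ Pm := (prod_Ico_le_prod_range ε j s hε0).trans hprod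
    refine (remainder_term_le hL hN₀ hE₀ hPm hDsq hs ε (card s) (a s) hε0 hsub (hcard0 s hs) (hcard s hs)
      (hinv s hs) (ha0 s hs) (ha s hs)).trans ?_
    exact mul_le_mul_of_nonneg_left (geometry_factor_le hL hs) hKc0
  calc ∑ s ∈ Finset.range j, (∏ u ∈ Finset.Ico (s + 1) j, ((1 + ε u) * L)) *
        (card s * ((1 + (ε s)⁻¹) * (435 * (Dsq / 4 * a s) ^ 2) ^ 2))
      ≤ ∑ s ∈ Finset.range j, Kc * (2 / L ^ 4) ^ (j - s) := Finset.sum_le_sum hterm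
    _ = Kc * ∑ s ∈ Finset.range j, (2 / L ^ 4) ^ (j - s) := by rw [Finset.mul_sum]
    _ ≤ Kc * (1 / 3) := mul_le_mul_of_nonneg_left (sum_ratio_pow_le hL j) hKc0
    _ = (1 / 3) * Kc := mul_comm _ _

end Summit.QuantumFields.YangMills.Theorems.HistoryTailRemainder

end
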